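import Mathlib
import Literature.AlgebraicGeometry.Motives.FunctionFieldOver
import Literature.AlgebraicGeometry.Resolution.AlterationsProofs

/-!
# ResolutionOfSingularities / pAlteration — `Assembly2`, function-field glue

Helpers for item `stmt-ResolutionOfSingularities-10476` (route decl `PAlteration.Assembly2`).
For a dominant morphism `f : X ⟶ Y` of integral schemes which is finite and universally
injective over an affine open `V ⊆ Y` containing the generic point, the extension of function
fields `K(X) / K(Y)` (in-tree `FunctionFieldOver f`, algebra structure `RatFn.functionFieldMap f`)
is finite and purely inseparable. Also: the restriction `f ∣_ V` over an affine open with affine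
preimage is, up to the canonical isomorphisms, `Spec` of `f.app V`.
-/

noncomputable section

open CategoryTheory AlgebraicGeometry TopologicalSpace Opposite

namespace Summit.ResolutionOfSingularities.ResolutionOfSingularities.Theorems

set_option linter.dupNamespace false -- mandated namespace of this single-conjunct summit

universe u

/-! ## Restriction over an affine open with affine preimage -/

section Transport

variable {X Y : Scheme.{u}} (f : X ⟶ Y) {U : Y.Opens}

/-- Over an affine open `U` with affine preimage, `f ∣_ U` is `Spec (f.app U)` up to the
canonical isomorphisms `U ≅ Spec Γ(Y, U)`, `f⁻¹U ≅ Spec Γ(X, f⁻¹U)`. [folklore] -/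
theorem isoSpec_inv_morphismRestrict_isoSpec_hom (hU : IsAffineOpen U)
    (hU' : IsAffineOpen (f ⁻¹ᵁ U)) :
    hU'.isoSpec.inv ≫ (f ∣_ U) ≫ hU.isoSpec.hom = Spec.map (f.app U) := by
  rw [← cancel_mono hU.fromSpec]
  simp only [Category.assoc, IsAffineOpen.isoSpec_hom_fromSpec, morphismRestrict_ι,
    IsAffineOpen.isoSpec_inv_ι_assoc]
  rw [Scheme.Hom.app_eq_appLE, IsAffineOpen.SpecMap_appLE_fromSpec f hU hU' le_rfl]

/-- A property of morphisms respecting isomorphisms holds for `f ∣_ U` iff it holds for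
`Spec (f.app U)` (`U` affine with affine preimage). [folklore] -/
theorem morphismRestrict_iff_specMap_app (hU : IsAffineOpen U) (hU' : IsAffineOpen (f ⁻¹ᵁ U))
    {P : MorphismProperty Scheme.{u}} [P.RespectsIso] :
    P (f ∣_ U) ↔ P (Spec.map (f.app U)) := by
  rw [← isoSpec_inv_morphismRestrict_isoSpec_hom f hU hU', P.cancel_left_of_respectsIso,
    P.cancel_right_of_respectsIso]

/-- A property stable under base change passes from `f ∣_ V` to `f ∣_ U` for `U ≤ V`.
[folklore] -/
theorem morphismRestrict_of_le {P : MorphismProperty Scheme.{u}} [P.IsStableUnderBaseChange]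
    {U V : Y.Opens} (e : U ≤ V) (h : P (f ∣_ V)) : P (f ∣_ U) := by
  have sq : IsPullback (X.homOfLE (f.preimage_mono e)) (f ∣_ U) (f ∣_ V) (Y.homOfLE e) := by
    refine IsPullback.of_right (h₁₂ := (f ⁻¹ᵁ V).ι) (h₂₂ := V.ι) ?_
      (morphismRestrict_homOfLE f U V e).symm (isPullback_morphismRestrict f V).flip
    simpa only [Scheme.homOfLE_ι] using (isPullback_morphismRestrict f U).flip
  exact MorphismProperty.of_isPullback sq h

/-- If `f ∣_ U` is an affine morphism and `U` is affine then `f⁻¹U` is affine. [folklore] -/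
theorem isAffineOpen_preimage_of_isAffineHom_morphismRestrict (hU : IsAffineOpen U)
    [IsAffineHom (f ∣_ U)] : IsAffineOpen (f ⁻¹ᵁ U) := by
  haveI : IsAffine (U : Scheme.{u}) := hU
  exact isAffine_of_isAffineHom (f ∣_ U)

end Transport

/-! ## The function field extension of a generically finite radicial dominant morphism -/

section FunctionField

open Literature.AlgebraicGeometry.Motives Literature.AlgebraicGeometry.Motives.RatFn

variable {X Y : Scheme.{u}} [IsIntegral X] [IsIntegral Y] (f : X ⟶ Y) [IsDominant f]
  {V : Y.Opens}

/-- Sections over `f⁻¹V` are integral over `K(Y)` when `Γ(Y, V) → Γ(X, f⁻¹V)` is finite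
(variant of the in-tree `FunctionFieldOver.isIntegral_ofPreimageSection` without a global
finiteness hypothesis on `f`). [folklore] -/
theorem isIntegral_ofPreimageSection_of_finite (hV : genericPoint Y ∈ V) (hfin : (f.app V).hom.Finite)
    (σ : Γ(X, f ⁻¹ᵁ V)) :
    IsIntegral Y.functionField (FunctionFieldOver.ofPreimageSection f hV σ) := by
  letI := (f.app V).hom.toAlgebra
  have hint : IsIntegral Γ(Y, V) σ := hfin.to_isIntegral σ
  refine hint.map_of_comp_eq (Y.presheaf.germ V (genericPoint Y) hV).hom
    ((FunctionFieldOver.of f).toRingHom.comp (X.presheaf.germ (f ⁻¹ᵁ V) (genericPoint X)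
      (genericPoint_mem_preimage f hV)).hom) ?_
  ext r
  exact functionFieldMap_ofSection f hV r

/-- `K(X) = K(Y)[Γ(f⁻¹V, 𝒪_X)]` when `f⁻¹V` is affine and `Γ(Y, V) → Γ(X, f⁻¹V)` is finite
(variant of the in-tree `FunctionFieldOver.adjoin_range_ofPreimageSection_eq_top`). [folklore] -/
theorem adjoin_range_ofPreimageSection_eq_top_of_finite (hV : genericPoint Y ∈ V) (hVaff' : IsAffineOpen (f ⁻¹ᵁ V))
    (hfin : (f.app V).hom.Finite) :
    Algebra.adjoin Y.functionField (Set.range (FunctionFieldOver.ofPreimageSection f hV)) = ⊤ := by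
  haveI : Nonempty (f ⁻¹ᵁ V : X.Opens) := ⟨⟨_, genericPoint_mem_preimage f hV⟩⟩
  haveI := functionField_isFractionRing_of_isAffineOpen (X := X) (f ⁻¹ᵁ V) hVaff'
  rw [eq_top_iff]
  rintro x -
  obtain ⟨a, b, hb, rfl⟩ :=
    IsFractionRing.div_surjective (A := Γ(X, f ⁻¹ᵁ V)) (show X.functionField from x)
  have ha : (algebraMap Γ(X, f ⁻¹ᵁ V) X.functionField a : FunctionFieldOver f) ∈
      Algebra.adjoin Y.functionField (Set.range (FunctionFieldOver.ofPreimageSection f hV)) :=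
    Algebra.subset_adjoin ⟨a, rfl⟩
  have hb' : (algebraMap Γ(X, f ⁻¹ᵁ V) X.functionField b : FunctionFieldOver f) ∈
      Algebra.adjoin Y.functionField (Set.range (FunctionFieldOver.ofPreimageSection f hV)) :=
    Algebra.subset_adjoin ⟨b, rfl⟩
  exact Subalgebra.mul_mem _ ha
    ((isIntegral_ofPreimageSection_of_finite f hV hfin b).inv_mem hb')

/-- **`K(X)/K(Y)` is finite** for a dominant morphism of integral schemes which is finite over an
affine open `V ∋ ξ_Y` with affine preimage (variant of the in-tree
`FunctionFieldOver.finiteDimensional`, which assumes `f` finite everywhere). [folklore] -/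
theorem finiteDimensional_functionFieldOver_of_finite (hV : genericPoint Y ∈ V)
    (hVaff' : IsAffineOpen (f ⁻¹ᵁ V))
    (hfin : (f.app V).hom.Finite) :
    FiniteDimensional Y.functionField (FunctionFieldOver f) := by
  classical
  letI := (f.app V).hom.toAlgebra
  haveI : Module.Finite Γ(Y, V) Γ(X, f ⁻¹ᵁ V) := hfin
  obtain ⟨G, hG⟩ := Module.finite_def.1 (inferInstance : Module.Finite Γ(Y, V) Γ(X, f ⁻¹ᵁ V))
  let s : Set (FunctionFieldOver f) :=
    (G.image (FunctionFieldOver.ofPreimageSection f hV) : Set _)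
  have hs : Algebra.adjoin Y.functionField s = ⊤ := by
    rw [eq_top_iff, ← adjoin_range_ofPreimageSection_eq_top_of_finite f hV hVaff' hfin,
      Algebra.adjoin_le_iff]
    rintro _ ⟨σ, rfl⟩
    have hσ : σ ∈ Submodule.span Γ(Y, V) (G : Set Γ(X, f ⁻¹ᵁ V)) := by rw [hG]; trivial
    refine Submodule.span_induction ?_ ?_ ?_ ?_ hσ
    · intro g hg
      exact Algebra.subset_adjoin (Finset.mem_image_of_mem _ hg)
    · change FunctionFieldOver.ofPreimageSection f hV 0 ∈ _
      rw [map_zero]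
      exact Subalgebra.zero_mem _
    · intro a b _ _ ha hb
      change FunctionFieldOver.ofPreimageSection f hV (a + b) ∈ _
      rw [map_add]
      exact Subalgebra.add_mem _ ha hb
    · intro r a _ ha
      change FunctionFieldOver.ofPreimageSection f hV (r • a) ∈ _
      rw [Algebra.smul_def, RingHom.algebraMap_toAlgebra, map_mul,
        FunctionFieldOver.ofPreimageSection_app]
      exact Subalgebra.mul_mem _ (Subalgebra.algebraMap_mem _ _) ha
  have hfg : (Algebra.adjoin Y.functionField s).toSubmodule.FG :=
    fg_adjoin_of_finite (G.image (FunctionFieldOver.ofPreimageSection f hV)).finite_toSet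
      fun x hx => by
        obtain ⟨σ, -, rfl⟩ := Finset.mem_image.1 hx
        exact isIntegral_ofPreimageSection_of_finite f hV hfin σ
  rw [hs, Algebra.top_toSubmodule] at hfg
  exact Module.Finite.of_fg_top hfg

/-- **`K(X)/K(Y)` is purely inseparable** for a dominant morphism of integral schemes such that
`Spec (f.app V)` is universally injective (radicial) for an affine open `V ∋ ξ_Y` with affine
preimage: two embeddings of `K(X) = Frac Γ(X, f⁻¹V)` into an algebraically closed field which
agree on `K(Y) ⊇ Γ(Y, V)` give two geometric points of `Spec Γ(X, f⁻¹V)` with the same image,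
hence agree on `Γ(X, f⁻¹V)` (Stacks 01S4), hence everywhere; so `K(X)/K(Y)` is an epimorphism of
fields, i.e. purely inseparable (Mathlib `IsPurelyInseparable.of_injective_comp_algebraMap`).
[folklore] -/
theorem isPurelyInseparable_functionFieldOver_of_universallyInjective (hV : genericPoint Y ∈ V)
    (hVaff' : IsAffineOpen (f ⁻¹ᵁ V)) [UniversallyInjective (Spec.map (f.app V))] :
    IsPurelyInseparable Y.functionField (FunctionFieldOver f) := by
  haveI : Nonempty (f ⁻¹ᵁ V : X.Opens) := ⟨⟨_, genericPoint_mem_preimage f hV⟩⟩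
  haveI := functionField_isFractionRing_of_isAffineOpen (X := X) (f ⁻¹ᵁ V) hVaff'
  let L := FunctionFieldOver f
  let Ω := AlgebraicClosure L
  haveI : Nonempty (L →+* Ω) := ⟨algebraMap L Ω⟩
  refine IsPurelyInseparable.of_injective_comp_algebraMap Y.functionField L Ω fun φ₁ φ₂ hφ => ?_
  -- the two ring maps `Γ(X, f⁻¹V) → Ω`
  set ψ₁ : Γ(X, f ⁻¹ᵁ V) →+* Ω := φ₁.comp (FunctionFieldOver.ofPreimageSection f hV) with hψ₁
  set ψ₂ : Γ(X, f ⁻¹ᵁ V) →+* Ω := φ₂.comp (FunctionFieldOver.ofPreimageSection f hV) with hψ₂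
  have hUI : ∀ (K : Type u) [Field K],
      Function.Injective (fun g : Spec (.of K) ⟶ Spec Γ(X, f ⁻¹ᵁ V) => g ≫ Spec.map (f.app V)) :=
    ((tfae_universallyInjective (Spec.map (f.app V))).out 0 1).mp ‹_›
  have hSpec : Spec.map (CommRingCat.ofHom ψ₁) = Spec.map (CommRingCat.ofHom ψ₂) := by
    apply hUI Ω
    change Spec.map (CommRingCat.ofHom ψ₁) ≫ Spec.map (f.app V) =
      Spec.map (CommRingCat.ofHom ψ₂) ≫ Spec.map (f.app V)
    rw [← Spec.map_comp, ← Spec.map_comp]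
    congr 1
    ext r
    change ψ₁ (f.app V r) = ψ₂ (f.app V r)
    simp only [hψ₁, hψ₂, RingHom.comp_apply]
    rw [FunctionFieldOver.ofPreimageSection_app]
    dsimp only at hφ
    exact DFunLike.congr_fun hφ (ofSection hV r)
  have hψ : ψ₁ = ψ₂ := by
    have h := Spec.map_injective hSpec
    simpa using congrArg CommRingCat.Hom.hom h
  -- `φ₁ = φ₂` on `K(X) = Frac Γ(X, f⁻¹V)`
  have key : φ₁.comp (FunctionFieldOver.of f).toRingHom =
      φ₂.comp (FunctionFieldOver.of f).toRingHom :=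
    IsLocalization.ringHom_ext (nonZeroDivisors Γ(X, f ⁻¹ᵁ V)) hψ
  exact RingHom.ext fun x => DFunLike.congr_fun key x

end FunctionField

end Summit.ResolutionOfSingularities.ResolutionOfSingularities.Theorems

end
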